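import Summits.QuantumFields.YangMills.Theorems.CurvaturePoincareBoxUhlenbeck
import Summits.QuantumFields.YangMills.Theorems.FluctuationComparisonRegPrIntLS2BetaFlatTubeDepthOneUniformTorus
import Summits.QuantumFields.YangMills.Theorems.UnitScaleTiltProp7AxialGauge
import Summits.QuantumFields.YangMills.Theorems.FluctuationComparisonRegPrIntLS2BetaClosePairOfOneStep
import HarnessLib

/-!
# THE INTRA-BLOCK HALF OF THE FLAT ORBIT FUNCTIONAL IS CONTROLLED WITH `μ = 1∕36` AT EVERY DEPTH AND EVERY VOLUME — the box Uhlenbeck lemma on the `m`-blocks, glued and rooted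
# (crux `FluctuationComparisonRegPrIntL`, stmt-QuantumFields-20520; registry v11.4 `Cruxes/FluctuationComparisonRegPrIntL/Lines/semiclassical_s2beta.lean` 3732b7df FROZEN, untouched)

Cell `ym3-torus` (YM ladder rung R3 = continuum `SU(2)` Yang–Mills on the three-torus — a RUNG: NOT d = 4, NOT infinite volume, NOT a mass gap, NOT Clay).
Width seat `ym3-torus-px12` (gen 22); `--kind proof --supports stmt-QuantumFields-20520 --as helper`, count-neutral, DEFINITION-FREE (0 `def`, 0 `instance`,
0 `notation`, 0 `sorry`, default heartbeats).

WHY.  The flat-datum growth letters of this seat (✓`…S2BetaFlatTubeDepthOneUniform`, ✓∕⧗`…S2BetaFlatTubeAllDepthsVolumeUniform`) are VOLUME-uniform but their constant decays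
geometrically in the DEPTH `K − J`; the registered GAP♯∘ ∕ px16 g19's `hFlat` want `μ` uniform in the depth as well ([Balaban1984PropagatorsII] (1.33) at `V = 1`).  This file
shows that the INTRA-BLOCK part of the orbit functional carries NO such loss: px19 g9's box Uhlenbeck lemma (✓`CurvaturePoincareBoxUhlenbeck.exists_gauge_sum_sq_le`: on a `ZMod` box of
side `n`, `Σ_{b ⊂ box} dist1((U^g)_b)² ≤ (3n)²·Σ_{p ⊂ box} dist1(U(∂p))²`, averaged axial gauges) applied to the `m`-blocks as boxes of side `L^m`, the per-block gauges normalised to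
`1` at the block centres (so the glued transformation is RESIDUAL for the `m`-fold descent) gives `Σ_{intra-block bonds} dist1(U ℓ·((w • 1) ℓ)⁻¹)² ≤ 9·L^{2m}·Σ_p dist1(U(∂p))² ≤
36·L^{2m}·A(U)`, i.e. `(1∕36)·L^{−2m}·Σ_{intra-block} ≤ A(U)` — DEPTH- and VOLUME-uniform, NO small-field hypothesis.  The whole depth-non-uniformity of the flat growth letter
therefore sits in the INTER-block bonds (a fraction `≈ 1∕L^m` of all bonds), where the averaging constraint must enter.

WHAT (member `F.P K`, `m ≤ F.m + K`, any `SU(2)` field — no fibre, no smallness).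
* §1 the `ZMod` box of an `m`-block: `val_corner`, `box_of_iterBlockOf` (a bond of the `m`-block of `y` lies in the box of side `L^m` at the corner of the block),
  `iterBlockOf_of_mem_boxPlaqs` (a box plaquette is based in the block).
* §2 ★★★ `exists_rooted_sum_intraBlock_sq_le` — `∃ w, (∀ y, w (embIter m y) = 1) ∧ Σ_{ℓ : B_m(ℓ₋) = B_m(ℓ₊)} dist1(U ℓ·((w • 1) ℓ)⁻¹)² ≤ 9·(L^m)²·Σ_p dist1(U(∂p))²`;
  ★★★ `sum_intraBlock_sq_le_action` — the same `≤ 36·(L^m)²·wilsonAction4 U`.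
* §3 ★★★ `exists_residual_sum_intraBlock_sq_le_action` — the same for `m = K − J` with `w` RESIDUAL for `D_{J,K}` (the registry's orbit-functional vocabulary).

HONEST: intra-block bonds only — the inter-block bonds (the averaging constraint, [Balaban1985RegularSpaces] Lemma 1 second half, in a depth-uniform `ℓ²` form) are NOT treated, so
this is NOT the depth-uniform flat growth letter; nothing of Bałaban's analysis; TUBE-REG∘, GAP♯∘, EXW∘, S2β, crux 20520 NOT proved; no registered stub is closed; rung R3 = SU(2) YM₃
on T³ — NOT d = 4, NOT infinite volume, NOT a mass gap, NOT Clay; the Yang–Mills mass gap is NOT proved.  Sorry-free, axioms standard.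

References: K. Uhlenbeck, CMP **83** (1982) 31–42 [Uhlenbeck1982] (the continuum statement); T. Bałaban, CMP **96** (1984) 223–250 [Balaban1984PropagatorsII] ((1.33)); CMP **99**
(1985) 75–102 [Balaban1985RegularSpaces] (Lemma 1 (1.25) p.79, first half); CMP **109** (1987) 249–301 [Balaban1987RG1] ((0.1)–(0.3) pp.251–252).
-/

set_option autoImplicit false

noncomputable section

namespace Summit.QuantumFields.YangMills.Theorems.FluctuationComparisonRegPrIntLS2BetaFlatInteriorDepthUniform

open Finset
open Literature.MathematicalPhysics.QuantumFieldTheory.Balaban1983to89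
open T4Continuum
open T3ContinuumYM3Torus
open T4AxialGaugeSmallField (boxPlaqs castSite castSite_apply)
open B7Prop1Explicit (e e_apply)
open B5Eq118OneStroke (iterBlockOf val_iterBlockOf)
open B15DeterminingSets (embIter)
open Literature.MathematicalPhysics.QuantumFieldTheory.BalabanImbrieJaffe1984to88.BIJ88RT51Background (iterBlockOf_embIter)
open Summit.QuantumFields.YangMills.Theorems.Prop7FlatHolonomy (sitesPerDir_zero_eq_mul_pow transfUp_eq_embIter)
open Summit.QuantumFields.YangMills.Theorems.FluctuationComparisonRegPrIntLS2BetaClosePairOfOneStep (residual_of_transfUp_eq_one)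
open Summit.QuantumFields.YangMills.Theorems.CurvaturePoincareBoxUhlenbeck (exists_gauge_sum_sq_le)
open Summit.QuantumFields.YangMills.Theorems.FluctuationComparisonRegPrIntLS2BetaFlatTubeDepthOneUniformTorus (sum_dist1_sq_plaq_le_four_mul_wilsonAction4)

open scoped Matrix.Norms.L2Operator

/-! ## §1 The `ZMod` box of an `m`-block -/

section Box

variable {P : Params} {m : ℕ}

/-- The corner label `y_μ·L^m` of the `m`-block of `y` is a genuine label of the finest torus: `(↑(y_μ·L^m)).val = y_μ·L^m`. [cite: Balaban1987RG1, (0.1)-(0.3) p.252] -/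
theorem val_corner (hm : m ≤ P.m + P.K) (y : Site P m) (μ : Fin P.d) :
    ((((y μ).val * P.L ^ m : ℕ) : ZMod (P.sitesPerDir 0))).val = (y μ).val * P.L ^ m := by
  rw [ZMod.val_natCast, Nat.mod_eq_of_lt]
  rw [sitesPerDir_zero_eq_mul_pow hm]
  exact Nat.mul_lt_mul_of_pos_right (ZMod.val_lt _) (pow_pos P.L_pos m)

/-- **A site of the `m`-block of `y` lies in the box of side `L^m` at the corner**: `(x_μ − ↑(y_μ L^m)).val < L^m`. [cite: Balaban1987RG1, (0.3) p.252] -/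
theorem box_of_iterBlockOf (hm : m ≤ P.m + P.K) {x : Site P 0} {y : Site P m} (hx : iterBlockOf m x = y) (μ : Fin P.d) :
    (x μ - (((y μ).val * P.L ^ m : ℕ) : ZMod (P.sitesPerDir 0))).val < P.L ^ m := by
  have hdiv : (x μ).val / P.L ^ m = (y μ).val := by rw [← val_iterBlockOf m hm x μ, hx]
  have hLm : 0 < P.L ^ m := pow_pos P.L_pos m
  have hlo : (y μ).val * P.L ^ m ≤ (x μ).val := by
    have h := Nat.div_mul_le_self (x μ).val (P.L ^ m)
    rwa [hdiv] at h
  have hhi : (x μ).val < (y μ).val * P.L ^ m + P.L ^ m := by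
    have h := Nat.lt_div_mul_add (a := (x μ).val) hLm
    rwa [hdiv] at h
  have hc := val_corner hm y μ
  rw [ZMod.val_sub (by rw [hc]; exact hlo), hc]
  omega

/-- **A box plaquette is based in the block**: `p ∈ boxPlaqs(corner, corner + L^m − 1) ⟹ B_m(p₋) = y`. [cite: Balaban1987RG1, (0.3) p.252] -/
theorem iterBlockOf_of_mem_boxPlaqs (hm : m ≤ P.m + P.K) (y : Site P m) (p : Plaq P 0)
    (hp : p ∈ boxPlaqs (P := P) (j := 0) (fun k => (((((y k).val * P.L ^ m : ℕ) : ZMod (P.sitesPerDir 0))).val : ℤ))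
      (fun k => (((((y k).val * P.L ^ m : ℕ) : ZMod (P.sitesPerDir 0))).val : ℤ) + (((P.L ^ m : ℕ) : ℤ) - 1))) :
    iterBlockOf m p.src = y := by
  obtain ⟨z, hlo, hhi, hsrc⟩ := hp
  have hLm : 0 < P.L ^ m := pow_pos P.L_pos m
  funext μ
  apply ZMod.val_injective
  rw [val_iterBlockOf m hm]
  have hc := val_corner hm y μ
  have hLm1 : (1 : ℤ) ≤ ((P.L : ℤ)) ^ m := by exact_mod_cast hLm
  have h1 : ((y μ).val : ℤ) * (P.L : ℤ) ^ m ≤ z μ := by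
    have h := hlo μ
    simp only [hc] at h
    push_cast at h
    exact h
  have h2 : z μ ≤ ((y μ).val : ℤ) * (P.L : ℤ) ^ m + ((P.L : ℤ) ^ m - 1) := by
    have h := hhi μ
    simp only [hc, Pi.add_apply, e_apply] at h
    have he1 : (0 : ℤ) ≤ (if μ = p.μ then 1 else 0) := by split_ifs <;> norm_num
    have he2 : (0 : ℤ) ≤ (if μ = p.ν then 1 else 0) := by split_ifs <;> norm_num
    push_cast at h
    linarith
  have hy0 : (0 : ℤ) ≤ ((y μ).val : ℤ) * (P.L : ℤ) ^ m := by positivity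
  have hz0 : 0 ≤ z μ := hy0.trans h1
  have hzN : z μ < (P.sitesPerDir 0 : ℤ) := by
    have hy : (y μ).val * P.L ^ m + P.L ^ m ≤ P.sitesPerDir 0 := by
      rw [sitesPerDir_zero_eq_mul_pow hm, ← Nat.succ_mul]
      exact Nat.mul_le_mul_right _ (ZMod.val_lt _)
    have hy' : ((y μ).val : ℤ) * (P.L : ℤ) ^ m + (P.L : ℤ) ^ m ≤ (P.sitesPerDir 0 : ℤ) := by exact_mod_cast hy
    linarith
  -- `(p.src μ).val = z μ`
  have hval : ((p.src μ).val : ℤ) = z μ := by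
    rw [hsrc, castSite_apply, ZMod.val_intCast]
    exact Int.emod_eq_of_lt hz0 hzN
  obtain ⟨n, hn⟩ := Int.eq_ofNat_of_zero_le hz0
  have hvaln : (p.src μ).val = n := by exact_mod_cast (hval.trans hn)
  rw [hvaln]
  rw [hn] at h1 h2
  have h1' : (y μ).val * P.L ^ m ≤ n := by exact_mod_cast h1
  have h2' : n < (y μ).val * P.L ^ m + P.L ^ m := by
    have h : (n : ℤ) < ((y μ).val : ℤ) * (P.L : ℤ) ^ m + (P.L : ℤ) ^ m := by linarith
    exact_mod_cast h
  exact Nat.div_eq_of_lt_le h1' (by rw [add_one_mul]; exact h2')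

end Box

/-! ## §2 The intra-block orbit functional: `μ = 1∕36` at every depth and volume -/

section Intra

variable (F : T3Family)

/-- ★★★ **THE INTRA-BLOCK HALF OF THE FLAT ORBIT FUNCTIONAL, DEPTH- AND VOLUME-UNIFORMLY**: for every member `F.P K`, every depth `m ≤ F.m + K` and EVERY `SU(2)` field `U` there is
a transformation `w ≡ 1` at the `m`-block centres (hence RESIDUAL for the `m`-fold descent) with
`Σ_{ℓ : B_m(ℓ₋) = B_m(ℓ₊)} dist1(U ℓ·((w • 1) ℓ)⁻¹)² ≤ 9·(L^m)²·Σ_p dist1(U(∂p))²` (px19 g9's box Uhlenbeck lemma on every `m`-block, the box gauges normalised at the centres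
and glued). [cite: Balaban1985RegularSpaces, Lemma 1 (1.25) p.79; Balaban1984PropagatorsII, (1.33)] -/
theorem exists_rooted_sum_intraBlock_sq_le (K m : ℕ) (hm : m ≤ F.m + K) (U : GaugeField (F.P K) 0 (Matrix.specialUnitaryGroup (Fin 2) ℂ)) :
    ∃ w : Site (F.P K) 0 → (Matrix.specialUnitaryGroup (Fin 2) ℂ), (∀ y : Site (F.P K) m, w (embIter m y) = 1) ∧
      ∑ ℓ ∈ univ.filter (fun ℓ : PBond (F.P K) 0 => iterBlockOf m ℓ.src = iterBlockOf m ℓ.tgt),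
          dist1 (U ℓ * ((GaugeField.gaugeAct w (1 : GaugeField (F.P K) 0 (Matrix.specialUnitaryGroup (Fin 2) ℂ))) ℓ)⁻¹) ^ 2 ≤
        9 * ((F.L : ℝ) ^ m) ^ 2 * ∑ p : Plaq (F.P K) 0, dist1 (GaugeField.plaqHol U p) ^ 2 := by
  classical
  have hk : m ≤ (F.P K).m + (F.P K).K := hm
  have hLm : 0 < F.L ^ m := pow_pos (F.P K).L_pos m
  have hn : 1 ≤ (F.P K).L ^ m := hLm
  have h2n : 2 * (F.P K).L ^ m ≤ (F.P K).sitesPerDir 0 := by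
    show 2 * F.L ^ m ≤ 2 * F.L ^ (F.m + K - 0)
    exact Nat.mul_le_mul_left _ (Nat.pow_le_pow_right (F.P K).L_pos (by omega))
  -- the box gauges, one per `m`-block
  have hex : ∀ y : Site (F.P K) m, ∃ g : GaugeTransf (F.P K) 0 (Matrix.specialUnitaryGroup (Fin 2) ℂ),
      (∑ b ∈ univ.filter (fun b : PBond (F.P K) 0 =>
          (∀ k, (b.src k - (fun μ => ((((y μ).val * (F.P K).L ^ m : ℕ)) : ZMod ((F.P K).sitesPerDir 0))) k).val < (F.P K).L ^ m) ∧
          (∀ k, (b.tgt k - (fun μ => ((((y μ).val * (F.P K).L ^ m : ℕ)) : ZMod ((F.P K).sitesPerDir 0))) k).val < (F.P K).L ^ m)),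
          dist1 (GaugeField.gaugeAct g U b) ^ 2) ≤
        (3 * (((F.P K).L ^ m : ℕ) : ℝ)) ^ 2 * (∑ p ∈ univ.filter (fun p : Plaq (F.P K) 0 => p ∈ boxPlaqs (P := F.P K) (j := 0)
          (fun k => (((fun μ => ((((y μ).val * (F.P K).L ^ m : ℕ)) : ZMod ((F.P K).sitesPerDir 0))) k).val : ℤ))
          (fun k => (((fun μ => ((((y μ).val * (F.P K).L ^ m : ℕ)) : ZMod ((F.P K).sitesPerDir 0))) k).val : ℤ) + ((((F.P K).L ^ m : ℕ) : ℤ) - 1))),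
          dist1 (GaugeField.plaqHol U p) ^ 2) :=
    fun y => exists_gauge_sum_sq_le F K U hn h2n _
  choose g hg using hex
  refine ⟨fun x => (g (iterBlockOf m x) x)⁻¹ * g (iterBlockOf m x) (embIter m (iterBlockOf m x)), fun y => ?_, ?_⟩
  · simp only [iterBlockOf_embIter m hk y, inv_mul_cancel]
  -- reorganise the intra-block sum by blocks
  set f : PBond (F.P K) 0 → ℝ := fun ℓ => dist1 (U ℓ * ((GaugeField.gaugeAct
      (fun x => (g (iterBlockOf m x) x)⁻¹ * g (iterBlockOf m x) (embIter m (iterBlockOf m x))) (1 : GaugeField (F.P K) 0 (Matrix.specialUnitaryGroup (Fin 2) ℂ))) ℓ)⁻¹) ^ 2 with hf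
  have hf0 : ∀ ℓ, 0 ≤ f ℓ := fun ℓ => sq_nonneg _
  rw [← Finset.sum_fiberwise (univ.filter (fun ℓ : PBond (F.P K) 0 => iterBlockOf m ℓ.src = iterBlockOf m ℓ.tgt)) (fun ℓ => iterBlockOf m ℓ.src) f]
  -- per block: the glued transformation reads as the box gauge, and the intra-block bonds lie in the box
  have hblock : ∀ y : Site (F.P K) m,
      ∑ ℓ ∈ (univ.filter (fun ℓ : PBond (F.P K) 0 => iterBlockOf m ℓ.src = iterBlockOf m ℓ.tgt)).filter (fun ℓ => iterBlockOf m ℓ.src = y), f ℓ ≤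
        (3 * (((F.P K).L ^ m : ℕ) : ℝ)) ^ 2 * (∑ p ∈ univ.filter (fun p : Plaq (F.P K) 0 => p ∈ boxPlaqs (P := F.P K) (j := 0)
          (fun k => (((fun μ => ((((y μ).val * (F.P K).L ^ m : ℕ)) : ZMod ((F.P K).sitesPerDir 0))) k).val : ℤ))
          (fun k => (((fun μ => ((((y μ).val * (F.P K).L ^ m : ℕ)) : ZMod ((F.P K).sitesPerDir 0))) k).val : ℤ) + ((((F.P K).L ^ m : ℕ) : ℤ) - 1))),
          dist1 (GaugeField.plaqHol U p) ^ 2) := by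
    intro y
    refine le_trans ?_ (hg y)
    refine le_trans (le_of_eq (Finset.sum_congr rfl fun ℓ hℓ => ?_)) (Finset.sum_le_sum_of_subset_of_nonneg (fun ℓ hℓ => ?_) fun _ _ _ => sq_nonneg _)
    · -- the value on an intra-block bond of block `y`
      rw [Finset.mem_filter, Finset.mem_filter] at hℓ
      obtain ⟨⟨-, hst⟩, hsy⟩ := hℓ
      have hty : iterBlockOf m ℓ.tgt = y := hst ▸ hsy
      simp only [hf]
      have e : U ℓ * ((GaugeField.gaugeAct
          (fun x => (g (iterBlockOf m x) x)⁻¹ * g (iterBlockOf m x) (embIter m (iterBlockOf m x))) (1 : GaugeField (F.P K) 0 (Matrix.specialUnitaryGroup (Fin 2) ℂ))) ℓ)⁻¹ =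
          (g y ℓ.src)⁻¹ * GaugeField.gaugeAct (g y) U ℓ * ((g y ℓ.src)⁻¹)⁻¹ := by
        show U ℓ * ((g (iterBlockOf m ℓ.src) ℓ.src)⁻¹ * g (iterBlockOf m ℓ.src) (embIter m (iterBlockOf m ℓ.src)) * 1 *
            ((g (iterBlockOf m ℓ.tgt) ℓ.tgt)⁻¹ * g (iterBlockOf m ℓ.tgt) (embIter m (iterBlockOf m ℓ.tgt)))⁻¹)⁻¹ =
          (g y ℓ.src)⁻¹ * (g y ℓ.src * U ℓ * (g y ℓ.tgt)⁻¹) * ((g y ℓ.src)⁻¹)⁻¹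
        rw [hsy, hty]
        group
      rw [e, GaugeGroup.dist1_conj]
    · rw [Finset.mem_filter, Finset.mem_filter] at hℓ
      obtain ⟨⟨-, hst⟩, hsy⟩ := hℓ
      have hty : iterBlockOf m ℓ.tgt = y := hst ▸ hsy
      rw [Finset.mem_filter]
      exact ⟨Finset.mem_univ _, fun k => box_of_iterBlockOf hk hsy k, fun k => box_of_iterBlockOf hk hty k⟩
  -- the box plaquette sums add up to at most the total
  have hplaq : ∑ y : Site (F.P K) m, ∑ p ∈ univ.filter (fun p : Plaq (F.P K) 0 => p ∈ boxPlaqs (P := F.P K) (j := 0)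
          (fun k => (((fun μ => ((((y μ).val * (F.P K).L ^ m : ℕ)) : ZMod ((F.P K).sitesPerDir 0))) k).val : ℤ))
          (fun k => (((fun μ => ((((y μ).val * (F.P K).L ^ m : ℕ)) : ZMod ((F.P K).sitesPerDir 0))) k).val : ℤ) + ((((F.P K).L ^ m : ℕ) : ℤ) - 1))),
          dist1 (GaugeField.plaqHol U p) ^ 2 ≤ ∑ p : Plaq (F.P K) 0, dist1 (GaugeField.plaqHol U p) ^ 2 := by
    rw [← Finset.sum_fiberwise (univ : Finset (Plaq (F.P K) 0)) (fun p => iterBlockOf m p.src) (fun p => dist1 (GaugeField.plaqHol U p) ^ 2)]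
    refine Finset.sum_le_sum fun y _ => Finset.sum_le_sum_of_subset_of_nonneg (fun p hp => ?_) fun _ _ _ => sq_nonneg _
    rw [Finset.mem_filter] at hp ⊢
    exact ⟨Finset.mem_univ _, iterBlockOf_of_mem_boxPlaqs hk y p hp.2⟩
  have hL : (((F.P K).L ^ m : ℕ) : ℝ) = (F.L : ℝ) ^ m := by push_cast; rfl
  calc ∑ y : Site (F.P K) m, ∑ ℓ ∈ (univ.filter (fun ℓ : PBond (F.P K) 0 => iterBlockOf m ℓ.src = iterBlockOf m ℓ.tgt)).filter
          (fun ℓ => iterBlockOf m ℓ.src = y), f ℓ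
      ≤ ∑ y : Site (F.P K) m, (3 * (((F.P K).L ^ m : ℕ) : ℝ)) ^ 2 * (∑ p ∈ univ.filter (fun p : Plaq (F.P K) 0 => p ∈ boxPlaqs (P := F.P K) (j := 0)
          (fun k => (((fun μ => ((((y μ).val * (F.P K).L ^ m : ℕ)) : ZMod ((F.P K).sitesPerDir 0))) k).val : ℤ))
          (fun k => (((fun μ => ((((y μ).val * (F.P K).L ^ m : ℕ)) : ZMod ((F.P K).sitesPerDir 0))) k).val : ℤ) + ((((F.P K).L ^ m : ℕ) : ℤ) - 1))),
          dist1 (GaugeField.plaqHol U p) ^ 2) := Finset.sum_le_sum fun y _ => hblock y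
    _ = (3 * (((F.P K).L ^ m : ℕ) : ℝ)) ^ 2 * ∑ y : Site (F.P K) m, ∑ p ∈ univ.filter (fun p : Plaq (F.P K) 0 => p ∈ boxPlaqs (P := F.P K) (j := 0)
          (fun k => (((fun μ => ((((y μ).val * (F.P K).L ^ m : ℕ)) : ZMod ((F.P K).sitesPerDir 0))) k).val : ℤ))
          (fun k => (((fun μ => ((((y μ).val * (F.P K).L ^ m : ℕ)) : ZMod ((F.P K).sitesPerDir 0))) k).val : ℤ) + ((((F.P K).L ^ m : ℕ) : ℤ) - 1))),
          dist1 (GaugeField.plaqHol U p) ^ 2 := by rw [Finset.mul_sum]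
    _ ≤ (3 * (((F.P K).L ^ m : ℕ) : ℝ)) ^ 2 * ∑ p : Plaq (F.P K) 0, dist1 (GaugeField.plaqHol U p) ^ 2 := mul_le_mul_of_nonneg_left hplaq (sq_nonneg _)
    _ = 9 * ((F.L : ℝ) ^ m) ^ 2 * ∑ p : Plaq (F.P K) 0, dist1 (GaugeField.plaqHol U p) ^ 2 := by rw [hL]; ring

/-- ★★★ **THE SAME AGAINST THE WILSON ACTION**: `Σ_{intra-block} dist1(U ℓ·((w • 1) ℓ)⁻¹)² ≤ 36·(L^m)²·wilsonAction4 U`, i.e. `(1∕36)·L^{−2m}·Σ_{intra-block} ≤ A(U)` — the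
intra-block half of the flat growth letter with a DEPTH- and VOLUME-uniform constant and no small-field hypothesis. [cite: Balaban1984PropagatorsII, (1.33); Balaban1985UV3, (11) p.258] -/
theorem sum_intraBlock_sq_le_action (K m : ℕ) (hm : m ≤ F.m + K) (U : GaugeField (F.P K) 0 (Matrix.specialUnitaryGroup (Fin 2) ℂ)) :
    ∃ w : Site (F.P K) 0 → (Matrix.specialUnitaryGroup (Fin 2) ℂ), (∀ y : Site (F.P K) m, w (embIter m y) = 1) ∧
      (1 / 36 : ℝ) * ((F.L : ℝ)⁻¹) ^ (2 * m) *
        ∑ ℓ ∈ univ.filter (fun ℓ : PBond (F.P K) 0 => iterBlockOf m ℓ.src = iterBlockOf m ℓ.tgt),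
          dist1 (U ℓ * ((GaugeField.gaugeAct w (1 : GaugeField (F.P K) 0 (Matrix.specialUnitaryGroup (Fin 2) ℂ))) ℓ)⁻¹) ^ 2 ≤ wilsonAction4 U := by
  obtain ⟨w, hw, hsum⟩ := exists_rooted_sum_intraBlock_sq_le F K m hm U
  refine ⟨w, hw, ?_⟩
  have hA := sum_dist1_sq_plaq_le_four_mul_wilsonAction4 U
  have hL0 : (0 : ℝ) < (F.L : ℝ) := by exact_mod_cast (F.P K).L_pos
  have hLm : (0 : ℝ) < ((F.L : ℝ) ^ m) ^ 2 := by positivity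
  have hinv : ((F.L : ℝ)⁻¹) ^ (2 * m) = (((F.L : ℝ) ^ m) ^ 2)⁻¹ := by rw [pow_mul, inv_pow, inv_pow, ← pow_mul, ← pow_mul, mul_comm]
  rw [hinv]
  rw [show (1 / 36 : ℝ) * (((F.L : ℝ) ^ m) ^ 2)⁻¹ * _ = (∑ ℓ ∈ univ.filter (fun ℓ : PBond (F.P K) 0 => iterBlockOf m ℓ.src = iterBlockOf m ℓ.tgt),
          dist1 (U ℓ * ((GaugeField.gaugeAct w (1 : GaugeField (F.P K) 0 (Matrix.specialUnitaryGroup (Fin 2) ℂ))) ℓ)⁻¹) ^ 2) / (36 * ((F.L : ℝ) ^ m) ^ 2) by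
    field_simp]
  rw [div_le_iff₀ (by positivity)]
  nlinarith

end Intra

/-! ## §3 In the orbit-functional vocabulary of the registry: a RESIDUAL transformation for the descent `D_{J,K}` -/

section Residual

open T3UnitLawDensityEML (ℰp)
open T3TiltDescent (descendTo)

variable (F : T3Family)

/-- ★★★ **THE INTRA-BLOCK HALF OF THE FLAT GROWTH LETTER WITH `μ = 1∕36` UNIFORM IN DEPTH AND VOLUME**: for `J ≤ K` and EVERY `SU(2)` field `U` on run `K`'s finest lattice there
is a transformation `w` RESIDUAL for the descent `D_{J,K}` (`D_{J,K}(w • U″) = D_{J,K} U″` for all `U″`, ✓`residual_of_transfUp_eq_one`) with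
`(1∕36)·(L⁻¹)^{2(K−J)}·Σ_{ℓ : B_{K−J}(ℓ₋) = B_{K−J}(ℓ₊)} dist1(U ℓ·((w • 1) ℓ)⁻¹)² ≤ wilsonAction4 U` — no fibre, no small-field hypothesis, no `ε₀`; the constant of the
registry's `UniformFibreGapOrbit` restricted to the INTRA-block bonds is therefore depth-free (the depth loss of ✓`…S2BetaFlatTubeAllDepthsVolumeUniform` is an INTER-block affair).
[cite: Balaban1984PropagatorsII, (1.33); Balaban1985Variational, (4) p.278] -/
theorem exists_residual_sum_intraBlock_sq_le_action {J K : ℕ} (hJK : J ≤ K) (U : GaugeField (F.P K) 0 (Matrix.specialUnitaryGroup (Fin 2) ℂ)) :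
    ∃ w : Site (F.P K) 0 → (Matrix.specialUnitaryGroup (Fin 2) ℂ),
      (∀ U'' : GaugeField (F.P K) 0 (Matrix.specialUnitaryGroup (Fin 2) ℂ), descendTo F ℰp J K hJK (GaugeField.gaugeAct w U'') = descendTo F ℰp J K hJK U'') ∧
      (1 / 36 : ℝ) * ((F.L : ℝ)⁻¹) ^ (2 * (K - J)) *
        ∑ ℓ ∈ univ.filter (fun ℓ : PBond (F.P K) 0 => iterBlockOf (K - J) ℓ.src = iterBlockOf (K - J) ℓ.tgt),
          dist1 (U ℓ * ((GaugeField.gaugeAct w (1 : GaugeField (F.P K) 0 (Matrix.specialUnitaryGroup (Fin 2) ℂ))) ℓ)⁻¹) ^ 2 ≤ wilsonAction4 U := by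
  obtain ⟨w, hw, hsum⟩ := sum_intraBlock_sq_le_action F K (K - J) (by omega) U
  refine ⟨w, residual_of_transfUp_eq_one F hJK ?_, hsum⟩
  funext y
  rw [transfUp_eq_embIter]
  exact hw y

end Residual

end Summit.QuantumFields.YangMills.Theorems.FluctuationComparisonRegPrIntLS2BetaFlatInteriorDepthUniform

end
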